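import Mathlib
import Summits.Ventures.PercRepro.TriangleCapRowTPieces
import Summits.Ventures.PercRepro.TriangleCapRowTCap
import Summits.Ventures.PercRepro.TriangleCapRowA2Five

/-!
# PercRepro — EVERY ROW `r = a + j` OF THE STABILITY TABLE WITH `a ≤ j + 4` (`r ≥ 2a − 4`), `5 ≤ a ≤ 18`,
`k ≥ 3a + j`: on the cell `(k, a, a + j)` every `K₄⁻`-free graph that is not `a`-bipartite is at least
`2k − 14 + 2j (a − 3)` below the closed form — the one-triangle gap, for EVERY `j` (p3, gen 49; part 203f)

The complement of part 202g (`a ≥ j + 5`, the `(j + 1)`-broom gap): where `a ≤ j + 4` the one-triangle family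
`tFamilyGen (k − 1) a (j + 2)` is the closer of the two families (`2k − 14 + 2j (a − 3) ≤ 2 (k − a − 3) + 2j (a − 2)`
exactly when `a ≤ j + 4`) and the theorem gives its gap. The rows `j ≤ 2` are parts 200x / 201d (the cells
`(k, 5, 6)`, `(k, 5, 7)`, `(k, 6, 8)`); for `j ≥ 3` a strong induction on `j`: the cap is `cap_T_regime` (part 203e),
every degree `≥ a` is the window `rowTreg_window`, and a vertex `z` of degree `d ≤ a − 1` is deleted onto
`(k − 1, a, d + j)` — a `B2` cell, the `T` cell, the `B2` cell `r = a − 1`, the cell `r = a + j′` with `j′ + 5 ≤ a`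
at its `(j′ + 1)`-broom gap (part 202g), or with `a ≤ j′ + 4` at its one-triangle gap (the induction hypothesis) —
with the deletion arithmetic of part 203b; an `a`-bipartite `D − z` is read through `sides_Treg_gen` (lift / the
all-off read through the plain star bound / the crude mixed read at `d = 2`) and, at `d ≥ 3`, through the vertex
bound at an off-side neighbour `w₀` of `z` (`mixed_vertex_core_T`): at `x = t − 1` the leaf read of part 203a/203d,
at `x ≥ t` the plain read at the endpoints `x = t` and `x = min (d + j, a)` (`concave_endpoint'`, part 203c).
Axioms: standard.
-/

namespace PercRepro

namespace TriangleCap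

namespace C047

open Finset

universe u

/-- **EVERY ROW `r = a + j` WITH `a ≤ j + 4`** (the induction form): for every `j`, every finite `K₄⁻`-free graph on
`k ≥ 3a + j` vertices with `a (k − a) − (a + j)` edges, `5 ≤ a ≤ j + 4`, `a ≤ 18`, is `a`-bipartite or at least
`2k − 14 + 2j (a − 3)` below the closed form. -/
theorem rowTreg_second_order_aux (j : ℕ) :
    ∀ (W : Type u) [Fintype W] [DecidableEq W] (D : SimpleGraph W) [DecidableRel D.Adj], K4mFree D →
      ∀ a : ℕ, 5 ≤ a → a ≤ j + 4 → a ≤ 18 → 3 * a + j ≤ Fintype.card W →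
        D.edgeFinset.card + (a + j) = a * (Fintype.card W - a) →
        (∃ A : Finset W, A.card = a ∧ BipSub D A) ∨
          ∑ v, deg D v * deg D v + (a + j) * (Fintype.card W - 1 - (a + j)) +
              (2 * Fintype.card W - 14 + 2 * j * (a - 3)) ≤ D.edgeFinset.card * Fintype.card W := by
  induction j using Nat.strong_induction_on with
  | _ j ih =>
  intro W _ _ D _ hK a ha5 haj ha18 hk hm
  rcases Nat.lt_or_ge j 3 with hj3 | hj3
  · -- the rows `j = 1, 2` (`j = 0` is empty: `a ≤ 4`)
    interval_cases j
    · omega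
    · have ha : a = 5 := by omega
      rcases rowA1_second_order_gen'' D hK a (by omega) ha18 (by omega) hm with h | h
      · exact Or.inl h
      · right
        have e2 : 2 * Fintype.card W - 14 + 2 * 1 * (a - 3) = 2 * Fintype.card W - 10 := by omega
        rw [e2]
        exact h
    · rcases rowA2_second_order_min D hK a (by omega) ha18 (by omega) hm with h | h
      · exact Or.inl h
      · right
        have e2 : 2 * Fintype.card W - 14 + 2 * 2 * (a - 3) =
            min (2 * Fintype.card W + 2 * a - 14) (2 * Fintype.card W + 4 * a - 26) := by omega
        rw [e2]
        exact h
  · -- `j ≥ 3`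
    have hk2 : 2 * a + 2 ≤ Fintype.card W := by omega
    -- (A) a vertex at the cap
    by_cases hx : ∃ x, deg D x + a = Fintype.card W
    · obtain ⟨x, hx⟩ := hx
      exact cap_T_regime D hK a j ha5 hk hm x hx
    push Not at hx
    have hcap : ∀ v, deg D v + a ≤ Fintype.card W := fun v =>
      deg_add_le_card_of_dense D hK a (by omega) (by omega)
        (cap_arith a (Fintype.card W) D.edgeFinset.card (a + j) (by omega) (by omega)
          (below_cap_arith a (Fintype.card W) D.edgeFinset.card (a + j) (by omega) hm)) v
    have hcap' : ∀ v, deg D v + a + 1 ≤ Fintype.card W := fun v => by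
      have h1 := hcap v
      have h2 := hx v
      omega
    have hcap2 : ∀ v, deg D v ≤ (Fintype.card W - a - 2) + 1 := fun v => by have := hcap' v; omega
    -- (B) every degree `≥ a`: the window
    by_cases hdeg : ∀ v, a ≤ deg D v
    · exact Or.inr (rowTreg_window D a j ha5 hk hm hcap' hdeg)
    push Not at hdeg
    obtain ⟨z, hz⟩ := hdeg
    -- (C) the deletion bookkeeping: `D − z` on `(k − 1, a, d + j)`
    have hK' := k4mFree_del D hK z
    have hcard' := card_del z
    have hedges' := card_edges_del D z
    have hsq := sum_deg_sq_del D z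
    have hT := sum_del_nbhd_le D z (Fintype.card W - a - 2) hcap2
    obtain ⟨T, hTdef⟩ : ∃ T, ∑ w : {v : W // v ≠ z}, (if D.Adj w.1 z then deg (del D z) w else 0) = T := ⟨_, rfl⟩
    obtain ⟨S', hS'def⟩ : ∃ S', ∑ w : {v : W // v ≠ z}, deg (del D z) w * deg (del D z) w = S' := ⟨_, rfl⟩
    obtain ⟨m', hm'def⟩ : ∃ m', (del D z).edgeFinset.card = m' := ⟨_, rfl⟩
    rw [hTdef, hS'def] at hsq
    rw [hTdef] at hT
    rw [hm'def] at hedges'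
    have hcardV' : Fintype.card {v : W // v ≠ z} = Fintype.card W - 1 := by omega
    have hm' : (del D z).edgeFinset.card + (deg D z + j) = a * (Fintype.card {v : W // v ≠ z} - a) := by
      rw [hm'def, hcardV']
      exact below_cell_edges a (a + j) (deg D z + j) (deg D z) (Fintype.card W) D.edgeFinset.card m' hk2 (by omega)
        hedges' hm
    have hmd : m' + deg D z + (a + j) = a * (Fintype.card W - a) := by omega
    have hfin : S' + 2 * T + deg D z + deg D z * deg D z + (a + j) * (Fintype.card W - 1 - (a + j)) +
          (2 * Fintype.card W - 14 + 2 * j * (a - 3)) ≤ (m' + deg D z) * Fintype.card W →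
        ∑ v, deg D v * deg D v + (a + j) * (Fintype.card W - 1 - (a + j)) +
            (2 * Fintype.card W - 14 + 2 * j * (a - 3)) ≤ D.edgeFinset.card * Fintype.card W := by
      intro h
      rw [hsq, ← hedges']
      exact h
    -- the `a`-bipartite alternative of `D − z`: the mixed reads
    have hbip : ∀ A' : Finset {v : W // v ≠ z}, A'.card = a → BipSub (del D z) A' →
        (∃ A : Finset W, A.card = a ∧ BipSub D A) ∨
          (∑ v, deg D v * deg D v + (a + j) * (Fintype.card W - 1 - (a + j)) +
              (2 * Fintype.card W - 14 + 2 * j * (a - 3)) ≤ D.edgeFinset.card * Fintype.card W) := by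
      intro A' hA'card hB
      rcases sides_Treg_gen D a j ha5 haj hk hm z (by omega) A' hA'card hB hm' hcap2 with h | h |
        ⟨hd2, ⟨w₀, hw₀A, hw₀z⟩, ⟨w₁, hw₁A, hw₁z⟩, hTcrude⟩
      · exact Or.inl h
      · exact Or.inr h
      · right
        apply hfin
        rw [hTdef] at hTcrude
        rcases Nat.lt_or_ge (deg D z) 3 with hd3 | hd3
        · -- `d = 2`: the crude read
          have hd : deg D z = 2 := by omega
          have hS := sum_deg_sq_le_of_bipSub (del D z) A' hB a (deg D z + j) hA'card hm' (by omega)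
          rw [hS'def, hm'def, hcardV'] at hS
          rw [hd] at hS hTcrude hmd ⊢
          have hTc : T ≤ (Fintype.card W - a - 2) + a := by omega
          exact rowT_mixed_two a j (Fintype.card W) m' S' T ha5 haj hk hmd hS hTc
        · -- `d ≥ 3`: the vertex bound at `w₀`, with the leaf read at `x = t − 1`
          obtain ⟨t, s₀, x, hts, ht1, hs₀1, htx, hxr, hxa, hS, hT1, hT2, hleaf⟩ :=
            mixed_vertex_core_T D hK a (by omega) z A' hA'card hB (deg D z + j) (by omega) hm' hcap2 w₀ hw₀A hw₀z
              w₁ hw₁A hw₁z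
          rw [hS'def, hm'def, hcardV'] at hS hleaf
          rw [hTdef] at hT1 hT2 hleaf
          have hda : deg D z + 1 ≤ a := by omega
          rcases Nat.lt_or_ge x t with hxt | hxt
          · -- `x = t − 1`: the leaf read
            have hxt' : x + 1 = t := by omega
            have hL := hleaf hxt'
            rcases Nat.lt_or_ge s₀ 2 with hs₀ | hs₀
            · have hs₀' : s₀ = 1 := by omega
              have ht : t = deg D z - 1 := by omega
              rw [hs₀', ht] at hL
              simp only [Nat.sub_self, zero_mul, mul_zero, add_zero] at hL
              exact rowT_one_lo a j (deg D z) x (Fintype.card W) m' S' T hk hd3 hda (by omega) hmd hL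
            · exact rowT_two_lo a j (deg D z) t s₀ x (Fintype.card W) m' S' T hk hd3 hda hts ht1 hs₀ hxt' hmd hL
          · -- `x ≥ t`: the plain read at the endpoints `x = t` and `x = min (d + j, a)`
            have hC1 : S' + 2 * T + (deg D z + j) * (Fintype.card W - 1 - 1 - (deg D z + j)) +
                (2 * ((deg D z + j - x) * (x - 1)) + 2 * x) ≤
                m' * (Fintype.card W - 1) + 2 * (t * (Fintype.card W - a - 2)) + 2 * a +
                  2 * ((s₀ - 1) * (a + 1 - t)) := by omega
            have hC2 : S' + 2 * T + (deg D z + j) * (Fintype.card W - 1 - 1 - (deg D z + j)) +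
                (2 * ((deg D z + j - x) * (x - 1)) + 2 * x) ≤
                m' * (Fintype.card W - 1) + 2 * (t * (Fintype.card W - a - s₀)) + 2 * a +
                  2 * ((s₀ - 1) * (a + 1 - t)) := by omega
            by_cases hsa : deg D z + j ≤ a
            · rcases concave_endpoint' (deg D z + j) t (deg D z + j) x hxt hxr (le_refl _) with hg | hg
              · rcases Nat.lt_or_ge s₀ 2 with hs₀ | hs₀
                · have hs₀' : s₀ = 1 := by omega
                  have hST : S' + 2 * T + (deg D z + j) * (Fintype.card W - 1 - 1 - (deg D z + j)) +
                      (2 * ((deg D z + j - t) * (t - 1)) + 2 * t) ≤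
                      m' * (Fintype.card W - 1) + 2 * ((deg D z - 1) * (Fintype.card W - a - 2)) + 2 * a := by
                    rw [hs₀'] at hC1
                    have ht : t = deg D z - 1 := by omega
                    rw [ht] at hC1 hg ⊢
                    simp only [Nat.sub_self, zero_mul, mul_zero, add_zero] at hC1
                    omega
                  exact rowT_one_t a j (deg D z) t (Fintype.card W) m' S' T hk hd3 hda (by omega) hmd hST
                · have hST : S' + 2 * T + (deg D z + j) * (Fintype.card W - 1 - 1 - (deg D z + j)) +
                      (2 * ((deg D z + j - t) * (t - 1)) + 2 * t) ≤
                      m' * (Fintype.card W - 1) + 2 * (t * (Fintype.card W - a - s₀)) + 2 * a +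
                        2 * ((s₀ - 1) * (a + 1 - t)) := by omega
                  exact rowT_two_t a j (deg D z) t s₀ t (Fintype.card W) m' S' T hk hd3 hda hts ht1 hs₀ rfl hmd hST
              · rcases Nat.lt_or_ge s₀ 2 with hs₀ | hs₀
                · have hs₀' : s₀ = 1 := by omega
                  have hST : S' + 2 * T + (deg D z + j) * (Fintype.card W - 1 - 1 - (deg D z + j)) +
                      (2 * ((deg D z + j - (deg D z + j)) * (deg D z + j - 1)) + 2 * (deg D z + j)) ≤
                      m' * (Fintype.card W - 1) + 2 * ((deg D z - 1) * (Fintype.card W - a - 2)) + 2 * a := by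
                    rw [hs₀'] at hC1
                    have ht : t = deg D z - 1 := by omega
                    rw [ht] at hC1
                    simp only [Nat.sub_self, zero_mul, mul_zero, add_zero] at hC1
                    omega
                  exact rowT_one_hi_s a j (deg D z) (deg D z + j) (Fintype.card W) m' S' T haj hk hd3 hda hsa rfl
                    hmd hST
                · have hST : S' + 2 * T + (deg D z + j) * (Fintype.card W - 1 - 1 - (deg D z + j)) +
                      (2 * ((deg D z + j - (deg D z + j)) * (deg D z + j - 1)) + 2 * (deg D z + j)) ≤
                      m' * (Fintype.card W - 1) + 2 * (t * (Fintype.card W - a - s₀)) + 2 * a +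
                        2 * ((s₀ - 1) * (a + 1 - t)) := by omega
                  exact rowT_two_hi_s a j (deg D z) t s₀ (deg D z + j) (Fintype.card W) m' S' T hk hd3 hda hts
                    ht1 hs₀ hsa rfl hmd hST
            · push Not at hsa
              rcases concave_endpoint' (deg D z + j) t a x hxt hxa (by omega) with hg | hg
              · rcases Nat.lt_or_ge s₀ 2 with hs₀ | hs₀
                · have hs₀' : s₀ = 1 := by omega
                  have hST : S' + 2 * T + (deg D z + j) * (Fintype.card W - 1 - 1 - (deg D z + j)) +
                      (2 * ((deg D z + j - t) * (t - 1)) + 2 * t) ≤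
                      m' * (Fintype.card W - 1) + 2 * ((deg D z - 1) * (Fintype.card W - a - 2)) + 2 * a := by
                    rw [hs₀'] at hC1
                    have ht : t = deg D z - 1 := by omega
                    rw [ht] at hC1 hg ⊢
                    simp only [Nat.sub_self, zero_mul, mul_zero, add_zero] at hC1
                    omega
                  exact rowT_one_t a j (deg D z) t (Fintype.card W) m' S' T hk hd3 hda (by omega) hmd hST
                · have hST : S' + 2 * T + (deg D z + j) * (Fintype.card W - 1 - 1 - (deg D z + j)) +
                      (2 * ((deg D z + j - t) * (t - 1)) + 2 * t) ≤
                      m' * (Fintype.card W - 1) + 2 * (t * (Fintype.card W - a - s₀)) + 2 * a +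
                        2 * ((s₀ - 1) * (a + 1 - t)) := by omega
                  exact rowT_two_t a j (deg D z) t s₀ t (Fintype.card W) m' S' T hk hd3 hda hts ht1 hs₀ rfl hmd hST
              · rcases Nat.lt_or_ge s₀ 2 with hs₀ | hs₀
                · have hs₀' : s₀ = 1 := by omega
                  have hST : S' + 2 * T + (deg D z + j) * (Fintype.card W - 1 - 1 - (deg D z + j)) +
                      (2 * ((deg D z + j - a) * (a - 1)) + 2 * a) ≤
                      m' * (Fintype.card W - 1) + 2 * ((deg D z - 1) * (Fintype.card W - a - 2)) + 2 * a := by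
                    rw [hs₀'] at hC1
                    have ht : t = deg D z - 1 := by omega
                    rw [ht] at hC1
                    simp only [Nat.sub_self, zero_mul, mul_zero, add_zero] at hC1
                    omega
                  exact rowT_one_hi_a a j (deg D z) a (Fintype.card W) m' S' T haj hk hd3 hda (by omega) rfl hmd
                    hST
                · have hST : S' + 2 * T + (deg D z + j) * (Fintype.card W - 1 - 1 - (deg D z + j)) +
                      (2 * ((deg D z + j - a) * (a - 1)) + 2 * a) ≤
                      m' * (Fintype.card W - 1) + 2 * (t * (Fintype.card W - a - s₀)) + 2 * a +
                        2 * ((s₀ - 1) * (a + 1 - t)) := by omega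
                  exact rowT_two_hi_a a j (deg D z) t s₀ a (Fintype.card W) m' S' T hk hd3 hda hts ht1 hs₀
                    (by omega) rfl hmd hST
    -- (D) the cell of `D − z`
    rcases Nat.lt_or_ge (deg D z + j + 2) a with hs3 | hs3
    · -- `d + j ≤ a − 3`: a `B2` cell
      rcases below_second_order_all (del D z) hK' a (deg D z + j) (by omega) ha18 (by omega) (by omega) hm'
        with ⟨A', hA'card, hB⟩ | hgap
      · exact hbip A' hA'card hB
      · right
        apply hfin
        rw [hS'def, hm'def, hcardV'] at hgap
        exact rowT_del_B2 a j (deg D z) (Fintype.card W) m' S' T (by omega) hk hmd hgap hT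
    · rcases Nat.lt_or_ge (deg D z + j + 1) a with hs2 | hs2
      · -- `d + j = a − 2`: the `T` cell
        have hs : deg D z + j = a - 2 := by omega
        have hm'' : (del D z).edgeFinset.card + (a - 2) = a * (Fintype.card {v : W // v ≠ z} - a) := by
          rw [← hs]; exact hm'
        rcases rowT_second_order_gen (del D z) hK' a (a - 2) (by omega) ha18 (by omega) (by omega) hm''
          with ⟨A', hA'card, hB⟩ | hgap
        · exact hbip A' hA'card hB
        · right
          apply hfin
          rw [hS'def, hm'def, hcardV'] at hgap
          exact rowT_del_T a j (deg D z) (Fintype.card W) m' S' T ha5 (by omega) hk hmd hgap hT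
      · rcases Nat.lt_or_ge (deg D z + j) a with hs1 | hs1
        · -- `d + j = a − 1`: the `B2` cell `r = a − 1`
          have hs : deg D z + j = a - 1 := by omega
          have hm'' : (del D z).edgeFinset.card + (a - 1) = a * (Fintype.card {v : W // v ≠ z} - a) := by
            rw [← hs]; exact hm'
          rcases rowB_second_order_all (del D z) hK' a (a - 1) (by omega) ha18 (by omega) (by omega) hm''
            with ⟨A', hA'card, hB⟩ | hgap
          · exact hbip A' hA'card hB
          · right
            apply hfin
            rw [hS'def, hm'def, hcardV'] at hgap
            exact rowT_del_B a j (deg D z) (Fintype.card W) m' S' T ha5 haj (by omega) hk hmd hgap hT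
        · -- `d + j = a + j′`, `j′ ≤ j − 1`
          obtain ⟨j', hj'⟩ : ∃ j', deg D z + j = a + j' := ⟨deg D z + j - a, by omega⟩
          have hj'lt : j' < j := by omega
          have hm'' : (del D z).edgeFinset.card + (a + j') = a * (Fintype.card {v : W // v ≠ z} - a) := by
            rw [← hj']; exact hm'
          rcases Nat.lt_or_ge (j' + 4) a with hja | hja
          · -- `j′ + 5 ≤ a`: the `(j′ + 1)`-broom gap of the smaller row (part 202g)
            rcases rowJ_second_order (del D z) hK' a j' (by omega) ha18 (by omega) hm''
              with ⟨A', hA'card, hB⟩ | hgap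
            · exact hbip A' hA'card hB
            · right
              apply hfin
              rw [hS'def, hm'def, hcardV'] at hgap
              exact rowT_del_up_broom a j (deg D z) j' (Fintype.card W) m' S' T haj (by omega) hj' (by omega) hk
                hmd hgap hT
          · -- `a ≤ j′ + 4`: the induction hypothesis
            rcases ih j' hj'lt {v : W // v ≠ z} (del D z) hK' a ha5 hja ha18 (by omega) hm''
              with ⟨A', hA'card, hB⟩ | hgap
            · exact hbip A' hA'card hB
            · right
              apply hfin
              rw [hS'def, hm'def, hcardV'] at hgap
              exact rowT_del_up_T a j (deg D z) j' (Fintype.card W) m' S' T ha5 hja hj' (by omega) hk hmd hgap hT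

variable {V : Type*} [Fintype V] [DecidableEq V]

/-- **EVERY ROW `r = a + j` OF THE STABILITY TABLE WITH `a ≤ j + 4`, `5 ≤ a ≤ 18`, `3a + j ≤ k`:** `K₄⁻`-free,
`m + (a + j) = a (k − a)` ⇒ `a`-bipartite or `Σ_v d(v)² + (a + j)(k − 1 − (a + j)) + (2k − 14 + 2j (a − 3)) ≤ m k`. -/
theorem rowTreg_second_order (D : SimpleGraph V) [DecidableRel D.Adj] (hK : K4mFree D) (a j : ℕ)
    (ha5 : 5 ≤ a) (haj : a ≤ j + 4) (ha18 : a ≤ 18) (hk : 3 * a + j ≤ Fintype.card V)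
    (hm : D.edgeFinset.card + (a + j) = a * (Fintype.card V - a)) :
    (∃ A : Finset V, A.card = a ∧ BipSub D A) ∨
      ∑ v, deg D v * deg D v + (a + j) * (Fintype.card V - 1 - (a + j)) +
          (2 * Fintype.card V - 14 + 2 * j * (a - 3)) ≤ D.edgeFinset.card * Fintype.card V :=
  rowTreg_second_order_aux j V D hK a ha5 haj ha18 hk hm

end C047

end TriangleCap

end PercRepro
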